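import Summits.BirchSwinnertonDyer.BirchSwinnertonDyer.Theorems.PrintCf2RamifiedOffTYZQFormDualCofactor
import Summits.BirchSwinnertonDyer.BirchSwinnertonDyer.Theorems.PrintCf2RamifiedOffTYZQFormConvolutionDefs
import HarnessLib

/-!
# Route `PrintCf2`, crux stmt-BirchSwinnertonDyer-20509 `RamifiedOffTYZOfFacts` — THE SUBSET-CONVOLUTION CALCULUS of the even Ω-identity
# (cell `bsd-print-cf2`, LEAD of 20509 g14, line `offtyz-v7`, cycle 15; kernel helpers `--supports stmt-BirchSwinnertonDyer-20509`)

The bookkeeping layer of the forest-calculus proof of LEAD g13's research statement `EvenOmegaMatrixIdentity` (crux workfiles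
`Cruxes/RamifiedOffTYZOfFacts/Lines/offtyz_v7_EvenOmega.lean`, proof `Lines/offtyz_v7_EvenOmegaProof.md` §1, §5, §6): the rows (iii)/(iv) of the
identity are equalities between iterated SUBSET CONVOLUTIONS `(f ⋆ g)(X) = Σ_{A ⊆ X} f(A)·g(X∖A)` of the tree's block weights (`qwt`, `fwt`) and their
set exponentials (`setExp`), decorated by POINTINGS `(p_v f)(X) = (Σ_X v)·f(X)`.  This file sets up that calculus once (nothing here is specific to
the congruent number problem except §3):

* §1 the algebra over `𝔽₂` of `sconv`, `spoint`, `sdelta` (definitions: sibling file `…QFormConvolutionDefs`): commutativity, associativity, bilinearity, unit, the Leibniz rule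
  `p_v(f ⋆ g) = (p_v f) ⋆ g + f ⋆ (p_v g)`, `setExp (f + g) = setExp f ⋆ setExp g` (the tree's `setExp_add`), `setExp f ⋆ setExp f = δ`
  (characteristic two), pointing an exponential `p_v (setExp f) = (p_v f) ⋆ setExp f` (the tree's `setExp_point`), and PAIR CANCELLATION
  `h ⋆ h = 0` for `h(∅) = 0` (an ordered pair of distinct blocks with identical weights cancels in characteristic two).
* §2 congruence lemmas: a convolution evaluated at `D` only sees `f` on the subsets `A ⊆ D` whose co-factor `g(D∖A)` is non-zero (parity transport).
* §3 the dictionary of exponentials for the reciprocity weights (`a s t + a t s = y_s y_t` on ALL of `V`): with `F = setExp(fwt a y z z)` (even blocks,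
  weight `q_z`), `W′ = setExp(fwt a y z 0)` (odd blocks, weight `(Σz)κ`), `Z = setExp(q_z)`, `Y = setExp(q_y)`: `Z = F ⋆ W′`, `setExp(q_{y+z}) = Y ⋆ Z`,
  `setExp(q_{y+z}) ⋆ W′ = Y ⋆ F`, `p_y Y = Y + δ` (the reciprocity lemma), `p_y Z = (p_y q_z) ⋆ Z` with `p_y q_z = fwt a y z 0`, `F(X) = 0` on odd `X`.
Pure finite combinatorics / linear algebra over `𝔽₂`; no number theory, no `sorry`.  BSD is not proved by any of this; no class is closed.

References: [cite: Stanley1999EC2, Cor. 5.1.6 (exponential formula; elementary finite form)]; [cite: Chaiken1982, §2 (all minors matrix tree theorem)];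
[cite: Smith2016CongruentDensity, §2.2]; crux notes `Lines/offtyz_v7_EvenOmegaProof.md` §1.
-/

namespace Summit.BirchSwinnertonDyer.PrintCf2.QFormForest

open Matrix Finset Literature.LinearAlgebra.Matrix Literature.Combinatorics.Enumerative
open Literature.NumberTheory.EllipticCurves.Smith2016

variable {V : Type*} [Fintype V] [LinearOrder V]

/-! ## §1. Subset convolution, pointing, and their algebra -/

omit [Fintype V] in
/-- **Commutativity** `f ⋆ g = g ⋆ f` (re-index `A ↦ X ∖ A`). [cite: Stanley1999EC2, Cor. 5.1.6] -/
theorem sconv_comm (f g : Finset V → ZMod 2) : sconv f g = sconv g f := by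
  funext X
  rw [sconv_apply, sconv_apply]
  refine sum_bij' (fun A _ => X \ A) (fun A _ => X \ A) ?_ ?_ ?_ ?_ ?_
  · intro A _; exact mem_powerset.mpr sdiff_subset
  · intro A _; exact mem_powerset.mpr sdiff_subset
  · intro A hA; rw [mem_powerset] at hA; exact Finset.sdiff_sdiff_eq_self hA
  · intro A hA; rw [mem_powerset] at hA; exact Finset.sdiff_sdiff_eq_self hA
  · intro A hA; rw [mem_powerset] at hA; rw [Finset.sdiff_sdiff_eq_self hA, mul_comm]

omit [Fintype V] in
/-- **Associativity** `(f ⋆ g) ⋆ h = f ⋆ (g ⋆ h)` (both are the sum over ordered triples of disjoint sets covering `X`).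
[cite: Stanley1999EC2, Cor. 5.1.6] -/
theorem sconv_assoc (f g h : Finset V → ZMod 2) : sconv (sconv f g) h = sconv f (sconv g h) := by
  funext X
  simp only [sconv_apply]
  -- left: Σ_{E ⊆ X} Σ_{A ⊆ E} f A g (E∖A) h (X∖E); regroup `E = A ∪ C`
  have hL : ∑ E ∈ X.powerset, (∑ A ∈ E.powerset, f A * g (E \ A)) * h (X \ E) =
      ∑ E ∈ X.powerset, ∑ A ∈ E.powerset, f A * g (E \ A) * h (X \ E) := by
    refine sum_congr rfl fun E _ => ?_
    rw [sum_mul]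
  rw [hL, sum_powerset_sum_powerset_sub]
  refine sum_congr rfl fun A hA => ?_
  rw [mul_sum]
  refine sum_congr rfl fun C hC => ?_
  rw [mem_powerset] at hC
  obtain ⟨h1, h2⟩ := union_sdiff_bookkeeping hC
  rw [h1, h2, mul_assoc]

omit [Fintype V] in
/-- Left distributivity `(f + f′) ⋆ g = f ⋆ g + f′ ⋆ g`. [cite: Stanley1999EC2, Cor. 5.1.6] -/
theorem sconv_add_left (f f' g : Finset V → ZMod 2) : sconv (f + f') g = sconv f g + sconv f' g := by
  funext X
  simp only [sconv_apply, Pi.add_apply, add_mul, sum_add_distrib]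

omit [Fintype V] in
/-- Right distributivity `f ⋆ (g + g′) = f ⋆ g + f ⋆ g′`. [cite: Stanley1999EC2, Cor. 5.1.6] -/
theorem sconv_add_right (f g g' : Finset V → ZMod 2) : sconv f (g + g') = sconv f g + sconv f g' := by
  rw [sconv_comm, sconv_add_left, sconv_comm g, sconv_comm g']

omit [Fintype V] in
/-- The unit: `f ⋆ δ = f`. [cite: Stanley1999EC2, Cor. 5.1.6] -/
theorem sconv_sdelta (f : Finset V → ZMod 2) : sconv f sdelta = f := by
  funext X
  rw [sconv_apply, ← add_sum_erase _ _ (mem_powerset_self X), sdiff_self, bot_eq_empty]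
  simp only [sdelta, if_true, mul_one]
  rw [sum_eq_zero, add_zero]
  intro A hA
  obtain ⟨hne, hA⟩ := mem_erase.mp hA
  rw [mem_powerset] at hA
  rw [if_neg, mul_zero]
  intro h
  rw [sdiff_eq_empty_iff_subset] at h
  exact hne (subset_antisymm hA h)

omit [Fintype V] in
/-- The unit: `δ ⋆ f = f`. [cite: Stanley1999EC2, Cor. 5.1.6] -/
theorem sdelta_sconv (f : Finset V → ZMod 2) : sconv sdelta f = f := by
  rw [sconv_comm, sconv_sdelta]

omit [Fintype V] in
/-- `0 ⋆ g = 0`. [cite: Stanley1999EC2, Cor. 5.1.6] -/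
theorem zero_sconv (g : Finset V → ZMod 2) : sconv 0 g = 0 := by
  funext X
  rw [sconv_apply, Pi.zero_apply]
  exact sum_eq_zero fun A _ => by rw [Pi.zero_apply, zero_mul]

omit [Fintype V] in
/-- `f ⋆ 0 = 0`. [cite: Stanley1999EC2, Cor. 5.1.6] -/
theorem sconv_zero (f : Finset V → ZMod 2) : sconv f 0 = 0 := by
  rw [sconv_comm, zero_sconv]

omit [Fintype V] [LinearOrder V] in
/-- In characteristic two `f + f = 0` for weights. [folklore] -/
theorem add_self_weight (f : Finset V → ZMod 2) : f + f = 0 := by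
  funext X
  exact CharTwo.add_self_eq_zero _

omit [Fintype V] [LinearOrder V] in
/-- **Pointing is additive in the weight.** [cite: Stanley1999EC2, Cor. 5.1.6] -/
theorem spoint_add (v : V → ZMod 2) (f g : Finset V → ZMod 2) : spoint v (f + g) = spoint v f + spoint v g := by
  funext X
  simp only [spoint_apply, Pi.add_apply, mul_add]

omit [Fintype V] [LinearOrder V] in
/-- Pointing twice by the same vector is pointing once (`u² = u` in `𝔽₂`). [folklore] -/
theorem spoint_spoint_self (v : V → ZMod 2) (f : Finset V → ZMod 2) : spoint v (spoint v f) = spoint v f := by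
  funext X
  rw [spoint_apply, spoint_apply, ← mul_assoc]
  have h : ∀ u : ZMod 2, u * u = u := by decide
  rw [h]

omit [Fintype V] [LinearOrder V] in
/-- Pointings commute. [folklore] -/
theorem spoint_comm (u v : V → ZMod 2) (f : Finset V → ZMod 2) : spoint u (spoint v f) = spoint v (spoint u f) := by
  funext X
  simp only [spoint_apply]
  ring

omit [Fintype V] in
/-- **The Leibniz rule**: `p_v (f ⋆ g) = (p_v f) ⋆ g + f ⋆ (p_v g)` (`Σ_X v = Σ_A v + Σ_{X∖A} v`). [cite: Stanley1999EC2, Cor. 5.1.6 (pointing a product)] -/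
theorem spoint_sconv (v : V → ZMod 2) (f g : Finset V → ZMod 2) :
    spoint v (sconv f g) = sconv (spoint v f) g + sconv f (spoint v g) := by
  funext X
  rw [Pi.add_apply, spoint_apply, sconv_apply, sconv_apply, sconv_apply, mul_sum, ← sum_add_distrib]
  refine sum_congr rfl fun A hA => ?_
  rw [mem_powerset] at hA
  rw [spoint_apply, spoint_apply]
  have hsplit : ∑ i ∈ X, v i = ∑ i ∈ A, v i + ∑ i ∈ X \ A, v i := by
    rw [← sum_union disjoint_sdiff, union_sdiff_of_subset hA]
  rw [hsplit]
  ring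

omit [Fintype V] in
/-- Pointing the unit kills it: `p_v δ = 0`. [folklore] -/
theorem spoint_sdelta (v : V → ZMod 2) : spoint v (sdelta : Finset V → ZMod 2) = 0 := by
  funext X
  rw [spoint_apply, Pi.zero_apply, sdelta]
  by_cases hX : X = ∅
  · rw [hX, sum_empty, zero_mul]
  · rw [if_neg hX, mul_zero]

omit [Fintype V] in
/-- **The exponential of a sum is the convolution of the exponentials** (the tree's `setExp_add`, in `⋆`-form).
[cite: Stanley1999EC2, Cor. 5.1.6 (exponential formula)] -/
theorem setExp_add_eq_sconv (f g : Finset V → ZMod 2) : setExp (f + g) = sconv (setExp f) (setExp g) := by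
  funext X
  rw [setExp_add, sconv_comm, sconv_apply]

omit [Fintype V] in
/-- **In characteristic two an exponential is a convolution involution**: `setExp f ⋆ setExp f = δ` (`= setExp (f + f) = setExp 0`).
[cite: Stanley1999EC2, Cor. 5.1.6] -/
theorem sconv_setExp_self (f : Finset V → ZMod 2) : sconv (setExp f) (setExp f) = sdelta := by
  rw [← setExp_add_eq_sconv, add_self_weight]
  funext X
  rw [sdelta]
  by_cases hX : X = ∅
  · rw [if_pos hX, hX, setExp_empty]
  · rw [if_neg hX, setExp_zero_of_nonempty (nonempty_iff_ne_empty.mpr hX)]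

omit [Fintype V] in
/-- **Pointing an exponential**: `p_v (setExp f) = (p_v f) ⋆ setExp f` (the tree's `setExp_point`). [cite: Stanley1999EC2, Cor. 5.1.6 (pointing a block)] -/
theorem spoint_setExp (v : V → ZMod 2) (f : Finset V → ZMod 2) : spoint v (setExp f) = sconv (spoint v f) (setExp f) := by
  funext X
  rw [spoint_apply, sconv_apply, ← setExp_point v f X]
  refine sum_congr rfl fun A _ => ?_
  rw [spoint_apply, mul_assoc]

omit [Fintype V] in
/-- **Peeling the block of a vertex**: for `j ∈ X`, `setExp f X = ((f·[j ∈ ·]) ⋆ setExp f)(X)`. [cite: Stanley1999EC2, Cor. 5.1.6] -/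
theorem setExp_eq_sconv_pin (f : Finset V → ZMod 2) {X : Finset V} {j : V} (hj : j ∈ X) :
    setExp f X = sconv (fun B => if j ∈ B then f B else 0) (setExp f) X := by
  rw [setExp_peel f hj, sconv_apply]
  have h1 : ∑ B ∈ (X.erase j).powerset, f (insert j B) * setExp f (X.erase j \ B) =
      ∑ B ∈ (X.erase j).powerset, (fun T => f T * setExp f (X \ T)) (insert j B) :=
    sum_congr rfl fun B _ => by rw [erase_sdiff_eq_sdiff_insert]
  rw [h1, ← sum_powerset_filter_mem_eq (fun T => f T * setExp f (X \ T)) hj, sum_filter]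
  refine sum_congr rfl fun B _ => ?_
  by_cases hjB : j ∈ B
  · rw [if_pos hjB, if_pos hjB]
  · rw [if_neg hjB, if_neg hjB, zero_mul]

omit [Fintype V] in
/-- **Pair cancellation**: a weight vanishing on `∅` convolves with ITSELF to zero in characteristic two (the summands `A` and `X ∖ A` pair off).
[cite: Stanley1999EC2, Cor. 5.1.6] -/
theorem sconv_self_eq_zero {h : Finset V → ZMod 2} (h0 : h ∅ = 0) : sconv h h = 0 := by
  funext X
  rw [sconv_apply, Pi.zero_apply]
  -- the involution `A ↦ X ∖ A` has no fixed point contributing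
  refine Finset.sum_involution (fun A _ => X \ A) ?_ ?_ ?_ ?_
  · intro A hA
    rw [mem_powerset] at hA
    rw [Finset.sdiff_sdiff_eq_self hA, mul_comm, CharTwo.add_self_eq_zero]
  · intro A hA hne
    rw [mem_powerset] at hA
    intro hfix
    apply hne
    -- `X ∖ A = A` forces `A = ∅ = X ∖ A`, where `h ∅ = 0`
    have hAe : A = ∅ := by
      have := disjoint_sdiff (s := A) (t := X)
      rw [hfix] at this
      exact disjoint_self.mp this
    rw [hAe, h0, zero_mul]
  · intro A _; exact mem_powerset.mpr sdiff_subset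
  · intro A hA; rw [mem_powerset] at hA; exact Finset.sdiff_sdiff_eq_self hA

/-! ## §2. Congruence under a co-factor -/

omit [Fintype V] in
/-- **Congruence of a convolution at one set**: if `f` and `f′` agree on every `A ⊆ X` whose co-factor `g(X∖A)` is non-zero, then
`(f ⋆ g)(X) = (f′ ⋆ g)(X)`. [cite: Stanley1999EC2, Cor. 5.1.6] -/
theorem sconv_congr_left {f f' g : Finset V → ZMod 2} {X : Finset V} (h : ∀ A, A ⊆ X → g (X \ A) ≠ 0 → f A = f' A) :
    sconv f g X = sconv f' g X := by
  rw [sconv_apply, sconv_apply]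
  refine sum_congr rfl fun A hA => ?_
  rw [mem_powerset] at hA
  by_cases hg : g (X \ A) = 0
  · rw [hg, mul_zero, mul_zero]
  · rw [h A hA hg]

omit [Fintype V] in
/-- The symmetric congruence: `(g ⋆ f)(X) = (g ⋆ f′)(X)` if `f = f′` wherever the co-factor `g` is non-zero. [cite: Stanley1999EC2, Cor. 5.1.6] -/
theorem sconv_congr_right {f f' g : Finset V → ZMod 2} {X : Finset V} (h : ∀ A, A ⊆ X → g (X \ A) ≠ 0 → f A = f' A) :
    sconv g f X = sconv g f' X := by
  rw [sconv_comm g f, sconv_comm g f', sconv_congr_left h]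

omit [Fintype V] in
/-- A convolution at `X` vanishes if every split has a vanishing factor. [cite: Stanley1999EC2, Cor. 5.1.6] -/
theorem sconv_eq_zero_of {f g : Finset V → ZMod 2} {X : Finset V} (h : ∀ A, A ⊆ X → f A * g (X \ A) = 0) : sconv f g X = 0 := by
  rw [sconv_apply]
  exact sum_eq_zero fun A hA => h A (mem_powerset.mp hA)

/-! ## §3. The exponentials of the reciprocity weights -/

section Reciprocity

variable (a : V → V → ZMod 2) (y z : V → ZMod 2)

/-- `fwt a y z z + fwt a y z 0 = q_z` (`(1 + Σy)q_z + (Σy)q_z`): the even and odd block weights add up to the root weight. [cite: Chaiken1982, §2] -/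
theorem fwt_self_add_fwt_zero_root : fwt a y z z + fwt a y z 0 = qwt a z := by
  funext B
  rw [Pi.add_apply, fwt, fwt_zero_root_apply]
  have e : ∀ u v : ZMod 2, u * v + v + u * v = v := by decide
  exact e _ _

/-- **`Z = F ⋆ W′`**: `setExp(q_z) = setExp(fwt a y z z) ⋆ setExp(fwt a y z 0)`. [cite: Stanley1999EC2, Cor. 5.1.6] [cite: Chaiken1982, §2] -/
theorem setExp_qwt_eq_sconv_self_zero_root : setExp (qwt a z) = sconv (setExp (fwt a y z z)) (setExp (fwt a y z 0)) := by
  rw [← fwt_self_add_fwt_zero_root a y z, setExp_add_eq_sconv]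

/-- **`E = Y ⋆ Z`**: `setExp(q_{y+z}) = setExp(q_y) ⋆ setExp(q_z)`. [cite: Stanley1999EC2, Cor. 5.1.6] [cite: ChebotarevAgaev2002, §4 Thm. 3] -/
theorem setExp_qwt_add_eq_sconv : setExp (qwt a (fun i => y i + z i)) = sconv (setExp (qwt a y)) (setExp (qwt a z)) := by
  rw [qwt_add_weight, setExp_add_eq_sconv]
where
  /-- `q_{y+z} = q_y + q_z` as weights. [cite: Chaiken1982, §2] -/
  qwt_add_weight : qwt a (fun i => y i + z i) = qwt a y + qwt a z := by
    funext B
    rw [Pi.add_apply, qwt_add]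

/-- **`E ⋆ W′ = Y ⋆ F`**: `setExp(q_{y+z}) ⋆ setExp(fwt a y z 0) = setExp(q_y) ⋆ setExp(fwt a y z z)` (`Z ⋆ W′ = F ⋆ W′ ⋆ W′ = F`).
[cite: Stanley1999EC2, Cor. 5.1.6] -/
theorem sconv_setExp_qwt_add_zero_root :
    sconv (setExp (qwt a (fun i => y i + z i))) (setExp (fwt a y z 0)) = sconv (setExp (qwt a y)) (setExp (fwt a y z z)) := by
  rw [setExp_qwt_add_eq_sconv, setExp_qwt_eq_sconv_self_zero_root a y z, sconv_assoc, sconv_assoc, sconv_setExp_self, sconv_sdelta]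

/-- **`Z ⋆ W′ = F`**. [cite: Stanley1999EC2, Cor. 5.1.6] -/
theorem sconv_setExp_qwt_zero_root : sconv (setExp (qwt a z)) (setExp (fwt a y z 0)) = setExp (fwt a y z z) := by
  rw [setExp_qwt_eq_sconv_self_zero_root a y z, sconv_assoc, sconv_setExp_self, sconv_sdelta]

/-- `p_y q_z = fwt a y z 0` (the odd block weight IS the root weight pointed by `y`). [cite: Chaiken1982, §2] -/
theorem spoint_qwt_eq_fwt_zero_root : spoint y (qwt a z) = fwt a y z 0 := by
  funext B
  rw [spoint_apply, fwt_zero_root_apply]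

/-- **`p_y Z = W′-weight ⋆ Z`**: `p_y setExp(q_z) = (fwt a y z 0) ⋆ setExp(q_z)`. [cite: Stanley1999EC2, Cor. 5.1.6] -/
theorem spoint_setExp_qwt : spoint y (setExp (qwt a z)) = sconv (fwt a y z 0) (setExp (qwt a z)) := by
  rw [spoint_setExp, spoint_qwt_eq_fwt_zero_root]

variable (hrec : ∀ i j : V, i ≠ j → a i j + a j i = y i * y j)
include hrec

/-- **`p_y Y = Y + δ`** — the reciprocity lemma in pointed form: `(Σ_X y)·setExp(q_y)(X) = setExp(q_y)(X)` for `X ≠ ∅`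
(`setExp(q_y)(X) = (Σ_X y) q_y(X)` and `u² = u`), and `= 0 = 1 + 1` at `X = ∅`. [cite: Smith2016CongruentDensity, §2.2 case 5(b)] [cite: HornJohnson2013, §0.8.5] -/
theorem spoint_setExp_qwt_self : spoint y (setExp (qwt a y)) = setExp (qwt a y) + sdelta := by
  funext X
  rw [spoint_apply, Pi.add_apply, sdelta]
  by_cases hX : X = ∅
  · rw [if_pos hX, hX, sum_empty, zero_mul, setExp_empty, CharTwo.add_self_eq_zero]
  · rw [if_neg hX, add_zero, setExp_qwt_eq_sum_mul_qwt a y (nonempty_iff_ne_empty.mpr hX) (fun i _ j _ hij => hrec i j hij),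
      ← mul_assoc]
    have h : ∀ u : ZMod 2, u * u = u := by decide
    rw [h]

/-- **`setExp(q_y)` vanishes on even nonempty sets** (reciprocity lemma). [cite: Smith2016CongruentDensity, §2.2 case 5(b)] -/
theorem setExp_qwt_self_eq_zero_of_even {X : Finset V} (hX : X.Nonempty) (hyX : ∑ i ∈ X, y i = 0) : setExp (qwt a y) X = 0 := by
  rw [setExp_qwt_eq_sum_mul_qwt a y hX (fun i _ j _ hij => hrec i j hij), hyX, zero_mul]

/-- **`F` vanishes on odd sets**: `setExp(fwt a y z z)(X) = det bigN a X y z z = (1 + Σ_X y)·(…) = 0` for `Σ_X y = 1` (marks into roots).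
[cite: Chaiken1982, §2] [cite: HornJohnson2013, §0.8.5] -/
theorem setExp_fwt_self_eq_zero_of_odd {X : Finset V} (hyX : ∑ i ∈ X, y i = 1) : setExp (fwt a y z z) X = 0 := by
  rw [← det_bigN_eq_setExp, det_bigN_mark_eq a y z (fun i _ j _ hij => hrec i j hij), hyX, CharTwo.add_self_eq_zero, zero_mul]

/-- **`W′` is supported where `Σ y = Σ z`** (parity theorem for the doubled matrix without root weights).
[cite: Chaiken1982, §2] [cite: HeathBrown1994SelmerCongruentII, Appendix (Monsky), typescript p. 40 L1–L31] -/
theorem setExp_fwt_zero_root_eq_zero_of_ne {X : Finset V} (h : ∑ i ∈ X, y i ≠ ∑ i ∈ X, z i) : setExp (fwt a y z 0) X = 0 := by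
  rw [← det_bigN_eq_setExp]
  exact det_bigN_zero_root_eq_zero a y z X (fun i _ j _ hij => hrec i j hij) h

/-- **Pointed reciprocity**: `p_v setExp(q_y) = p_y q_v` for EVERY pointing vector `v` — on a nonempty `X`, `setExp(q_y)(X) = (Σ_X y) q_y(X)`
(reciprocity lemma); if `Σ_X y = 1` both sides are `(Σ_X v)·κ(X)` by flatness, if `Σ_X y = 0` both vanish.  (At `v = z`: `p_z Y = fwt a y z 0`, the odd
block weight; at `v = y`: `p_y Y = p_y q_y`.) [cite: Smith2016CongruentDensity, §2.2 case 5(b)] [cite: Chaiken1982, §2] -/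
theorem spoint_setExp_qwt_eq (v : V → ZMod 2) : spoint v (setExp (qwt a y)) = spoint y (qwt a v) := by
  funext X
  rw [spoint_apply, spoint_apply]
  by_cases hX : X = ∅
  · rw [hX, sum_empty, sum_empty, zero_mul, zero_mul]
  rw [setExp_qwt_eq_sum_mul_qwt a y (nonempty_iff_ne_empty.mpr hX) (fun i _ j _ hij => hrec i j hij)]
  by_cases hyX : ∑ i ∈ X, y i = 1
  · obtain ⟨c, hc⟩ := nonempty_of_sum_eq_one hyX
    rw [qwt_eq_sum_mul_treeDet_of_odd a y y (fun i _ j _ hij => hrec i j hij) hyX hc,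
      qwt_eq_sum_mul_treeDet_of_odd a y v (fun i _ j _ hij => hrec i j hij) hyX hc, hyX, one_mul, one_mul, one_mul]
  · have h0 : ∑ i ∈ X, y i = 0 := by
      have h01 : ∀ u : ZMod 2, u ≠ 1 → u = 0 := by decide
      exact h01 _ hyX
    rw [h0, zero_mul, zero_mul, mul_zero]

/-- **`p_z Y = fwt a y z 0`**: pointing `setExp(q_y)` by `z` gives the odd block weight. [cite: Smith2016CongruentDensity, §2.2 case 5(b)] [cite: Chaiken1982, §2] -/
theorem spoint_setExp_qwt_eq_fwt_zero_root : spoint z (setExp (qwt a y)) = fwt a y z 0 := by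
  rw [spoint_setExp_qwt_eq a y hrec z, spoint_qwt_eq_fwt_zero_root]

/-- **Pointed flatness**: `p_u p_y q_v = p_v p_y q_u` — on an odd block both are `(Σ u)(Σ v) κ`, on an even block both vanish.
[cite: Smith2016CongruentDensity, §2.2 (all cofactors of a block d ≡ 3 (4) agree)] -/
theorem spoint_spoint_qwt_comm (u v : V → ZMod 2) : spoint u (spoint y (qwt a v)) = spoint v (spoint y (qwt a u)) := by
  rw [← spoint_setExp_qwt_eq a y hrec v, ← spoint_setExp_qwt_eq a y hrec u, spoint_comm]

/-- **Flatness transport for pointed root weights**: on an odd block `C` (`Σ_C y = 1`), `(Σ_C u)·q_v(C) = (Σ_C v)·q_u(C)`.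
[cite: Smith2016CongruentDensity, §2.2 (chunk p0008 L42–L50)] -/
theorem spoint_qwt_symm_of_odd (u v : V → ZMod 2) {C : Finset V} (hyC : ∑ i ∈ C, y i = 1) :
    spoint u (qwt a v) C = spoint v (qwt a u) C := by
  obtain ⟨c, hc⟩ := nonempty_of_sum_eq_one hyC
  rw [spoint_apply, spoint_apply, qwt_eq_sum_mul_treeDet_of_odd a y v (fun i _ j _ hij => hrec i j hij) hyC hc,
    qwt_eq_sum_mul_treeDet_of_odd a y u (fun i _ j _ hij => hrec i j hij) hyC hc]
  ring

end Reciprocity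

end Summit.BirchSwinnertonDyer.PrintCf2.QFormForest
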